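import Literature.Probability.RandomPlanarGeometry.RestrictionDensity
import HarnessLib

/-!
# [LSW] Lemma 3.5, continuity clause: `F(A) = P[K ∩ A = ∅]` is continuous on `𝒬₊`

G. F. Lawler, O. Schramm, W. Werner, *Conformal restriction: the chordal case*, J. Amer. Math.
Soc. **16** (2003) 917–955, arXiv:math/0209343 (**[LSW]**, arXiv page numbers), Lemma 3.5
(p. 12) in the proof of Prop. 3.3:

> **Lemma 3.5.** There exists a topology on `𝒬₊` for which `𝒜₀` is dense, `F` is continuous,
> and `Φ_A ↦ Φ_A'(0)` is continuous.

Here `F(A) = P[K ∩ A = ∅]` for a probability measure `P` on `Ω` satisfying hypothesis (1) of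
Prop. 3.3 ("Suppose 1 holds. Define the homomorphism `F` of `𝒬*` onto the multiplicative
semigroup `(0, 1]` by `F(A) = P[K ∩ A = ∅]`", p. 11), and the topology is the sequential
convergence defined at the start of the proof (p. 12), vendored as `Literature.Probability.RandomPlanarGeometry.LSWConverges`
in `RestrictionDensity` together with the semigroup `𝒜₀` (`IsLSWGenerated`), the density
clause (named fact `IsPlusHull.exists_isLSWGenerated_lswConverges`) and a PROOF of the third
clause (`LSWConverges.tendsto_restrictionDeriv`).

This file vendors the remaining, probabilistic clause as a named fact:

* `Literature.Probability.RandomPlanarGeometry.LSWConverges.tendsto_measure_avoid` — NAMED FACT, **`F` is continuous**: if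
  `A_n → A` in `𝒬₊` in the sense of the proof of Lemma 3.5, then `P[K ∩ A_n = ∅] → P[K ∩ A = ∅]`,
  for every probability measure `P` on `Ω` satisfying (1) in the homomorphism form
  (`RestrictionConfig.IsScaleInvariant`, `RestrictionConfig.IsHullMultiplicative`, see
  `RestrictionMeasures`) in which the proof of Prop. 3.3 uses it.

The printed proof (p. 12): with `A_n^+ = Φ_{A_n}(A ∖ A_n)`, `A_n^- = Φ_A(A_n ∖ A)` one shows
`A_n^+ ∪ A_n^- ⊆ {x + iy : x ∈ [δ, 1/δ], y ≤ δ_n}` with `δ_n → 0` (argument principle for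
`Φ_{A_n} ∘ Φ_A⁻¹ → id`, and the hulls being bounded away from `0` and `∞`); if
`limsup F(A_n) > F(A)` then "by mapping over with `Φ_A` and using 1" the configuration would meet
infinitely many `A_n^-` with positive probability, hence the real segment `[δ, 1/δ]`, which is
impossible; symmetrically for `liminf`. Not proved here (it needs uniform distortion bounds
for the maps `Φ_{A_n}`; a sibling `…Proofs` file is to discharge it). The assembly of
Prop. 3.3 (1) ⇒ (3) from this fact and the density fact is `RestrictionExponent`.

Proved API (non-vacuity of the hypothesis): the constant sequence `A_n = A` converges to `A`
(`lswConverges_const`), so the fact is consistent with, and for constant sequences reduces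
to, `F(A_n) = F(A)`.

## References

* [LSW] Lemma 3.5 (p. 12) and its proof (pp. 12–13) [LawlerSchrammWerner2003Restriction].
-/

noncomputable section

open Set Filter Metric MeasureTheory Bornology
open _root_.Topology
open UpperHalfPlane (upperHalfPlaneSet isOpen_upperHalfPlaneSet)
open scoped NNReal ENNReal

namespace Literature.Probability.RandomPlanarGeometry

open RestrictionConfig

/-- NAMED FACT — **[LSW] Lemma 3.5, continuity of `F`** (p. 12: "There exists a topology on `𝒬₊`
for which `𝒜₀` is dense, `F` is continuous, and `Φ_A ↦ Φ_A'(0)` is continuous", second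
clause, for the convergence of its proof): let `P` be a probability measure on `Ω` satisfying
hypothesis (1) of Prop. 3.3 in homomorphism form (`F(λA) = F(A)`, `F(A · A') = F(A) F(A')` for
`F(A) = P[K ∩ A = ∅]`). If `A, A_n ∈ 𝒬₊` with restriction maps `Φ_A`, `Φ_{A_n}` and `A_n → A`
in the sense of the proof of Lemma 3.5 (`LSWConverges`: `⋃ A_n` bounded away from `0` and `∞`,
`Φ_{A_n} → Φ_A` uniformly on compact subsets of `ℍ ∖ A`, which are eventually disjoint from
`A_n`, and uniformly near the marked point `0`), then `F(A_n) → F(A)`.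
[cite: LawlerSchrammWerner2003Restriction, Lemma 3.5 (p. 12), continuity of F; proof p. 12] -/
def LSWConverges.tendsto_measure_avoid : Prop :=
  ∀ (P : Measure RestrictionConfig), IsProbabilityMeasure P →
    IsScaleInvariant P → IsHullMultiplicative P →
      ∀ {A : Set ℂ} {Φ : ConformalEquiv (upperHalfPlaneSet \ A) upperHalfPlaneSet}
        {An : ℕ → Set ℂ} {Φn : ∀ n, ConformalEquiv (upperHalfPlaneSet \ An n) upperHalfPlaneSet},
        IsPlusHull A → IsRestrictionMap A Φ → (∀ n, IsPlusHull (An n)) →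
          (∀ n, IsRestrictionMap (An n) (Φn n)) → LSWConverges A Φ An Φn →
            Tendsto (fun n ↦ P (avoid (An n))) atTop (𝓝 (P (avoid A)))

/-! ### Non-vacuity: constant sequences converge -/

/-- A `*`-hull is bounded away from `0` and `∞`: `A ⊆ {δ ≤ |z| ≤ 1/δ}` for some `δ > 0`
(`A` is compact and `0 ∉ A`). [folklore] -/
theorem IsStarHull.exists_subset_norm_annulus {A : Set ℂ} (hA : IsStarHull A) :
    ∃ δ : ℝ, 0 < δ ∧ A ⊆ {z : ℂ | δ ≤ ‖z‖ ∧ ‖z‖ ≤ δ⁻¹} := by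
  obtain ⟨r, hr, hrA⟩ := hA.exists_disjoint_ball
  obtain ⟨R, hR⟩ := hA.isBoundedHull.isCompact.isBounded.subset_closedBall 0
  have hm : 0 < min r (|R| + 1)⁻¹ := lt_min hr (by positivity)
  refine ⟨min r (|R| + 1)⁻¹, hm, fun z hz ↦ ⟨?_, ?_⟩⟩
  · have h1 : r ≤ ‖z‖ := by
      by_contra hlt
      refine Set.disjoint_left.1 hrA (mem_ball_zero_iff.2 ?_) hz
      linarith [not_le.1 hlt]
    exact (min_le_left _ _).trans h1
  · have h2 : ‖z‖ ≤ R := mem_closedBall_zero_iff.1 (hR hz)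
    calc ‖z‖ ≤ |R| + 1 := h2.trans ((le_abs_self R).trans (by linarith))
      _ = ((|R| + 1)⁻¹)⁻¹ := (inv_inv _).symm
      _ ≤ (min r (|R| + 1)⁻¹)⁻¹ := by
          rw [inv_le_inv₀ (by positivity) hm]
          exact min_le_right _ _

/-- **Constant sequences converge** (non-vacuity of the hypothesis of the fact): `A_n = A`,
`Φ_{A_n} = Φ_A` converges to `A` in the sense of the proof of [LSW] Lemma 3.5, for every
`*`-hull `A`. [folklore] -/
theorem lswConverges_const {A : Set ℂ} (hA : IsStarHull A)
    (Φ : ConformalEquiv (upperHalfPlaneSet \ A) upperHalfPlaneSet) :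
    LSWConverges A Φ (fun _ ↦ A) (fun _ ↦ Φ) := by
  obtain ⟨δ, hδ, hAδ⟩ := hA.exists_subset_norm_annulus
  have hconst : ∀ S : Set ℂ, TendstoUniformlyOn (fun _ : ℕ ↦ (Φ : ℂ → ℂ)) Φ atTop S := fun S ↦
    Metric.tendstoUniformlyOn_iff.2 fun ε hε ↦ Eventually.of_forall fun n z _ ↦ by simpa using hε
  refine ⟨⟨δ, hδ, fun _ ↦ hAδ⟩, fun S _ hSA ↦ ⟨Eventually.of_forall fun _ ↦ ?_, hconst S⟩,
    ⟨1, one_pos, hconst _⟩⟩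
  exact Set.disjoint_left.2 fun z hz hzA ↦ (hSA hz).2 hzA

/-- For a constant sequence the fact asserts the trivial convergence `F(A) → F(A)` (sanity
check of the statement's shape). [folklore] -/
example (h : LSWConverges.tendsto_measure_avoid) (P : Measure RestrictionConfig)
    [IsProbabilityMeasure P] (hsc : IsScaleInvariant P) (hmul : IsHullMultiplicative P)
    {A : Set ℂ} (hA : IsPlusHull A) {Φ : ConformalEquiv (upperHalfPlaneSet \ A) upperHalfPlaneSet}
    (hΦ : IsRestrictionMap A Φ) :
    Tendsto (fun _ : ℕ ↦ P (avoid A)) atTop (𝓝 (P (avoid A))) :=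
  h P inferInstance hsc hmul hA hΦ (fun _ ↦ hA) (fun _ ↦ hΦ) (lswConverges_const hA.1 Φ)

end Literature.Probability.RandomPlanarGeometry

end
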